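import Literature.Probability.RandomPlanarGeometry.LoewnerInverseContinuity
import Literature.Probability.RandomPlanarGeometry.TipExtension
import HarnessLib

/-!
# Continuity of `H(y, t) = f̂ₜ(iy)` up to `y = 0` from grid derivative bounds (Lawler's Lemma 4.33)

Trunk T-STOCH. The deterministic core of the proof of Rohde–Schramm's Theorem 3.6
(*Basic properties of SLE*, Ann. Math. 161 (2005), pp. 895–898), in the architecture of
Lawler, *Conformally Invariant Processes in the Plane* (2005), Lemma 4.33: for the chordal
Loewner chain of a continuous driving function `W` with inverse maps `fₜ = gₜ⁻¹`,
`f̂ₜ(z) = fₜ(W t + z)` and `H(y, t) = f̂ₜ(iy)` (`Loewner.fHat`, `Loewner.tipApproach`), suppose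

* (4.27) the derivative bounds on the dyadic grid `|f̂'_{k 4^{-j}}(i 2^{-j})| ≤ c₁ 2^{(1-σ) j}`,
  `k < 4ʲ`, for some `σ > 0` (for SLE these hold almost surely, `SLEGridBounds.lean`, from
  Rohde–Schramm's Cor. 3.5 by Borel–Cantelli), and
* (4.28) the modulus `|W s - W t| ≤ c₂ √j 2^{-j}` for `s, t ≤ 2`, `|s - t| ≤ 4^{-j}`, `j ≥ 1` (for
  Brownian motion: Lévy's modulus of continuity, `Process/BrownianModulus.lean`).

Then `H` extends continuously from `{y > 0}` to `[0, ∞) × [0, 1)`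
(`Loewner.continuousOn_extendFrom_tipApproach`; the extension is Mathlib's
`extendFrom {p | p.1 ≠ 0} (tipApproach W)`).

The proof is Rohde–Schramm's (pp. 897–898) with Lawler's deterministic modulus in place of the
random partition `t̂ₙ`: for `(y, t)` in the box `[2^{-j-1}, 2^{-j}] × [t₀, t₀ + 4^{-j}]`,
`t₀ = k 4^{-j}`, the inverse cocycle gives `H(y, t) = f_{t₀}(w) = f̂_{t₀}(w - W t₀)` with
`w = f^{W(t₀+·)}_{t-t₀}(W t + iy)`, `im w ≥ y`, `|w - (W t + iy)| ≤ 2 · 4^{-j}/y ≤ 4 · 2^{-j}` (eq. (3.23)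
and the paragraph after it), so `w - W t₀` lies within `(5 + c₂ √j) 2^{-j}` of `i 2^{-j}` at
height `≥ 2^{-j-1}`; the chained Koebe distortion estimate
(`Literature.Analysis.Complex.AreaThm.norm_sub_le_chain`, "`|f̂ₜ'(z)|/|f̂ₜ'(i 2^{-j})|` is bounded
by some constant if `z ∈ S` (this follows from the Koebe distortion theorem)", p. 897) bounds
`|H(y, t) - H(2^{-j}, t₀)|` by `e^{O(√j)} 2^{-σ j}` (`Loewner.norm_tipApproach_sub_corner_le` and
the arithmetic `exp_mul_sqrt_le`), a summable sequence; the box-to-continuity step is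
`RohdeSchramm.modulus_of_box` / `continuousOn_extendFrom_of_modulus` (`TipExtension.lean`), and
continuity off the axis is `Loewner.continuousAt_tipApproach` (`LoewnerInverseContinuity.lean`).

## References

* S. Rohde, O. Schramm, *Basic properties of SLE*, Ann. of Math. 161 (2005), Thm. 3.6 and its
  proof, pp. 895–898 (eqs. (3.21)–(3.24)).
* G. F. Lawler, *Conformally Invariant Processes in the Plane*, AMS (2005), Lemma 4.33
  ((4.27), (4.28)), Rem. 4.30.
-/

noncomputable section

open Set Filter Topology Metric Complex
open UpperHalfPlane (upperHalfPlaneSet isOpen_upperHalfPlaneSet)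
open scoped NNReal

namespace Literature.Probability.RandomPlanarGeometry

namespace Loewner

variable {W : ℝ≥0 → ℝ}

/-! ### `f̂ₜ` on `ℍₒ` -/

/-- `f̂ₜ` is holomorphic on `ℍₒ` (`differentiableAt_fHat`). [folklore] -/
theorem differentiableOn_fHat (hW : Continuous W) (t : ℝ≥0) :
    DifferentiableOn ℂ (fHat W t) upperHalfPlaneSet :=
  fun _ hz ↦ (differentiableAt_fHat hW t hz).differentiableWithinAt

/-- `f̂ₜ` is injective on `ℍₒ` (apply `gₜ`: `gₜ (f̂ₜ z) = W t + z`, `map_fHat`). [folklore] -/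
theorem injOn_fHat (hW : Continuous W) (t : ℝ≥0) : InjOn (fHat W t) upperHalfPlaneSet := by
  intro z₁ hz₁ z₂ hz₂ h
  have h1 := map_fHat hW t (z := z₁) hz₁
  have h2 := map_fHat hW t (z := z₂) hz₂
  rw [h] at h1
  rw [h1] at h2
  exact add_left_cancel h2

/-! ### The box estimate -/

/-- `4^{-j} = (2^{-j})²` in `ℝ`. [folklore] -/
theorem inv_four_pow_eq_sq (j : ℕ) : ((4 : ℝ) ^ j)⁻¹ = (((2 : ℝ) ^ j)⁻¹) ^ 2 := by
  rw [← inv_pow, ← inv_pow, ← pow_mul, show (4 : ℝ)⁻¹ = (2⁻¹) ^ 2 by norm_num, ← pow_mul,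
    mul_comm]

/-- **The box estimate** (Rohde–Schramm (2005), proof of Thm. 3.6, eqs. (3.21)–(3.24);
Lawler (2005), proof of Lemma 4.33). Let `t₀ ≥ 0`, `0 ≤ r ≤ 4^{-j}`, `2^{-j-1} ≤ y ≤ 2^{-j}`, and
suppose `|W(t₀ + r) - W(t₀)| ≤ m 2^{-j}`. Then for every `n ≥ 4 (5 + m)`,
`|H(y, t₀ + r) - H(2^{-j}, t₀)| ≤ 2 (6 + m) 2^{-j} · n 12ⁿ · |f̂'_{t₀}(i 2^{-j})|`: by the inverse
cocycle `H(y, t₀ + r) = f̂_{t₀}(z)` with `z = f^{W(t₀+·)}_r(W(t₀+r) + iy) - W(t₀)`, where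
`im z ≥ y ≥ 2^{-j-1}` and `|z - i 2^{-j}| ≤ 2r/y + m 2^{-j} + 2^{-j-1} ≤ (5 + m) 2^{-j}`, and the chained
Koebe distortion bound for the conformal map `f̂_{t₀}` of `ℍₒ` at height `2^{-j-1}`
(`Literature.Analysis.Complex.AreaThm.norm_sub_le_chain`).
[cite: RohdeSchramm2005, Thm 3.6 (proof, (3.23)–(3.24))] -/
theorem norm_tipApproach_sub_corner_le (hW : Continuous W) {t₀ r y : ℝ≥0} {j n : ℕ} {m : ℝ}
    (hy1 : ((2 : ℝ≥0) ^ (j + 1))⁻¹ ≤ y) (hy2 : y ≤ ((2 : ℝ≥0) ^ j)⁻¹) (hr : r ≤ ((4 : ℝ≥0) ^ j)⁻¹)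
    (hm : |W (t₀ + r) - W t₀| ≤ m * ((2 : ℝ) ^ j)⁻¹) (hn : 4 * (5 + m) ≤ n) :
    dist (tipApproach W (y, t₀ + r)) (tipApproach W (((2 : ℝ≥0) ^ j)⁻¹, t₀)) ≤
      2 * ((6 + m) * ((2 : ℝ) ^ j)⁻¹) * n * 12 ^ n *
        ‖deriv (fHat W t₀) (I * (((((2 : ℝ≥0) ^ j)⁻¹ : ℝ≥0) : ℝ) : ℂ))‖ := by
  -- the scale `q = 2^{-j}`
  set q : ℝ := ((2 : ℝ) ^ j)⁻¹ with hq
  have hq0 : 0 < q := by positivity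
  have hcoe : ((((2 : ℝ≥0) ^ j)⁻¹ : ℝ≥0) : ℝ) = q := by push_cast; rfl
  have hy1' : q / 2 ≤ y := by
    have : ((((2 : ℝ≥0) ^ (j + 1))⁻¹ : ℝ≥0) : ℝ) ≤ y := by exact_mod_cast hy1
    push_cast at this
    rw [pow_succ, mul_inv] at this
    linarith
  have hy2' : (y : ℝ) ≤ q := by
    have : (y : ℝ) ≤ ((((2 : ℝ≥0) ^ j)⁻¹ : ℝ≥0) : ℝ) := by exact_mod_cast hy2
    rwa [hcoe] at this
  have hy0 : (0 : ℝ) < y := by linarith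
  have hr' : (r : ℝ) ≤ q ^ 2 := by
    have : (r : ℝ) ≤ ((((4 : ℝ≥0) ^ j)⁻¹ : ℝ≥0) : ℝ) := by exact_mod_cast hr
    push_cast at this
    rwa [inv_four_pow_eq_sq] at this
  have hm0 : 0 ≤ m := by
    have h := (abs_nonneg _).trans hm
    exact nonneg_of_mul_nonneg_left h hq0
  -- the starting point `z₁ = W(t₀ + r) + iy ∈ ℍₒ`
  have hz₁ : 0 < ((W (t₀ + r) : ℂ) + I * ((y : ℝ) : ℂ)).im := by simpa using hy0
  -- `H(y, t₀ + r) = f_{t₀}(w)` with `w = f^{W(t₀+·)}_r (z₁)`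
  have hV : Continuous fun u ↦ W (t₀ + u) := continuous_shift W hW t₀
  set w : ℂ := loewnerInv (fun u ↦ W (t₀ + u)) r ((W (t₀ + r) : ℂ) + I * ((y : ℝ) : ℂ)) with hw
  have hw_im : (y : ℝ) ≤ w.im := by
    simpa using im_le_im_loewnerInv hV r hz₁
  have hw_disp : ‖w - ((W (t₀ + r) : ℂ) + I * ((y : ℝ) : ℂ))‖ ≤ 4 * q := by
    have h := norm_loewnerInv_sub_self_le' hV r hz₁
    have him : ((W (t₀ + r) : ℂ) + I * ((y : ℝ) : ℂ)).im = y := by simp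
    rw [him] at h
    refine h.trans ?_
    rw [div_le_iff₀ hy0]
    nlinarith
  have e1 : tipApproach W (y, t₀ + r) = fHat W t₀ (w - W t₀) := by
    change loewnerInv W (t₀ + r) ((W (t₀ + r) : ℂ) + I * ((y : ℝ) : ℂ)) = _
    rw [loewnerInv_add hW t₀ r hz₁, fHat_apply, add_sub_cancel]
  have e2 : tipApproach W (((2 : ℝ≥0) ^ j)⁻¹, t₀) =
      fHat W t₀ (I * (((((2 : ℝ≥0) ^ j)⁻¹ : ℝ≥0) : ℝ) : ℂ)) := rfl
  rw [e1, e2, dist_eq_norm, hcoe]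
  -- the two points of `ℍₒ` to which the chained distortion estimate is applied
  have him0 : (I * (q : ℂ)).im = q := by simp
  have himz : (w - (W t₀ : ℂ)).im = w.im := by simp
  have hdist : ‖(w - (W t₀ : ℂ)) - I * (q : ℂ)‖ ≤ (5 + m) * q := by
    have hsplit : (w - (W t₀ : ℂ)) - I * (q : ℂ) =
        (w - ((W (t₀ + r) : ℂ) + I * ((y : ℝ) : ℂ))) +
          (((W (t₀ + r) - W t₀ : ℝ) : ℂ) + I * (((y : ℝ) - q : ℝ) : ℂ)) := by
      push_cast
      ring
    rw [hsplit]
    refine (norm_add_le _ _).trans ?_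
    have h2 : ‖((W (t₀ + r) - W t₀ : ℝ) : ℂ) + I * (((y : ℝ) - q : ℝ) : ℂ)‖ ≤ m * q + q := by
      refine (norm_add_le _ _).trans (add_le_add ?_ ?_)
      · rw [Complex.norm_real, Real.norm_eq_abs]
        exact hm
      · rw [norm_mul, Complex.norm_I, one_mul, Complex.norm_real, Real.norm_eq_abs, abs_sub_comm,
          abs_of_nonneg (by linarith)]
        linarith
    linarith
  have hM0 : (I * (q : ℂ)).im ≤ (6 + m) * q := by
    rw [him0]
    nlinarith
  have hMz : (w - (W t₀ : ℂ)).im ≤ (6 + m) * q := by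
    -- `im w ≤ y + |w - z₁| ≤ q + 4q`
    have h1 : (w - ((W (t₀ + r) : ℂ) + I * ((y : ℝ) : ℂ))).im ≤ 4 * q :=
      ((le_abs_self _).trans (Complex.abs_im_le_norm _)).trans hw_disp
    simp only [Complex.sub_im, Complex.add_im, Complex.ofReal_im, Complex.mul_im, Complex.I_re,
      Complex.I_im, Complex.ofReal_re, zero_mul, one_mul, zero_add] at h1
    rw [himz]
    nlinarith
  have hh0 : (0 : ℝ) < q / 2 := by positivity
  have hbase : q / 2 ≤ (I * (q : ℂ)).im := by rw [him0]; linarith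
  have hpt : q / 2 ≤ (w - (W t₀ : ℂ)).im := by rw [himz]; linarith
  have hstep : ‖(w - (W t₀ : ℂ)) - I * (q : ℂ)‖ ≤ n * (q / 2) / 2 := by
    refine hdist.trans ?_
    have : (5 + m) * q = 4 * (5 + m) * (q / 2) / 2 := by ring
    rw [this]
    gcongr
  have key := Literature.Analysis.Complex.AreaThm.norm_sub_le_chain (differentiableOn_fHat hW t₀)
    (injOn_fHat hW t₀) hh0 n hbase hpt hM0 hMz hstep
  simpa only [mul_assoc] using key

/-! ### Arithmetic: subexponential factors -/

/-- **`exp (b √x) ≤ exp (b²/(4a)) · exp (a x)`** for `a > 0`, `x ≥ 0` (from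
`(2a√x - b)² ≥ 0`): factors `e^{O(√j)}` are dominated by any exponential `e^{a j}`. This is the
content of the hypothesis "`lim_{j→∞} √j / log r_j = 0`" of Lawler (2005), Lemma 4.33, for
`r_j = 2^{-σ j}`. [folklore] -/
theorem exp_mul_sqrt_le (b : ℝ) {a x : ℝ} (ha : 0 < a) (hx : 0 ≤ x) :
    Real.exp (b * Real.sqrt x) ≤ Real.exp (b ^ 2 / (4 * a)) * Real.exp (a * x) := by
  rw [← Real.exp_add, Real.exp_le_exp]
  have key : 4 * a * (b * Real.sqrt x) ≤ 4 * a * (b ^ 2 / (4 * a) + a * x) := by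
    have e : 4 * a * (b ^ 2 / (4 * a) + a * x) = b ^ 2 + 4 * a ^ 2 * x := by
      field_simp
    rw [e]
    nlinarith [sq_nonneg (2 * a * Real.sqrt x - b), Real.sq_sqrt hx]
  exact le_of_mul_le_mul_left key (by positivity)

/-- `u + c √x ≤ (u + c) e^{√x}` for `u, c ≥ 0` (as `1 ≤ e^{√x}` and `√x ≤ e^{√x}`). [folklore] -/
theorem add_mul_sqrt_le_mul_exp {u c x : ℝ} (hu : 0 ≤ u) (hc : 0 ≤ c) :
    u + c * Real.sqrt x ≤ (u + c) * Real.exp (Real.sqrt x) := by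
  have e1 : 1 ≤ Real.exp (Real.sqrt x) := Real.one_le_exp (Real.sqrt_nonneg x)
  have e2 : Real.sqrt x ≤ Real.exp (Real.sqrt x) := by linarith [Real.add_one_le_exp (Real.sqrt x)]
  nlinarith [mul_le_mul_of_nonneg_left e2 hc]

/-! ### Lemma 4.33 -/

/-- **Continuity of `H(y, t) = f̂ₜ(iy)` up to the axis from grid derivative bounds and the
modulus of the driving function** (Lawler (2005), Lemma 4.33, with `r_j = c₁ 2^{-σ j}`; the
deterministic part of Rohde–Schramm (2005), Thm. 3.6, pp. 895–898). Let `W` be continuous and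
`σ > 0`. Assume the grid bounds `|f̂'_{k 4^{-j}}(i 2^{-j})| ≤ c₁ 2^{(1-σ) j}` for all `j` and
`k < 4ʲ` (hypothesis (4.27)), and the modulus `|W s - W t| ≤ c₂ √j / 2ʲ` for `j ≥ 1`,
`s, t ≤ 2`, `|s - t| ≤ 4^{-j}` (hypothesis (4.28)). Then the extension
`extendFrom {p | p.1 ≠ 0} H` of `H = tipApproach W` by limits is continuous on
`{(y, t) | t < 1}`; it agrees with `H` off the axis (`RohdeSchramm.extendFrom_eq_self`,
`Loewner.continuousAt_tipApproach`). [cite: Lawler2005, Lemma 4.33] -/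
theorem continuousOn_extendFrom_tipApproach (hW : Continuous W) {σ c₁ c₂ : ℝ} (hσ : 0 < σ)
    (hgrid : ∀ j k : ℕ, k < 4 ^ j →
      ‖deriv (fHat W ((k : ℝ≥0) / 4 ^ j)) (I * ((2 : ℝ) ^ (-(j : ℝ)) : ℝ))‖ ≤
        c₁ * (2 : ℝ) ^ ((1 - σ) * j))
    (hmodW : ∀ j : ℕ, 1 ≤ j → ∀ s t : ℝ≥0, s ≤ 2 → t ≤ 2 → dist s t ≤ ((4 : ℝ) ^ j)⁻¹ →
      |W s - W t| ≤ c₂ * Real.sqrt j / 2 ^ j) :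
    ContinuousOn (extendFrom {p | p.1 ≠ 0} (tipApproach W)) {p | p.2 < 1} := by
  -- nonnegative versions of the constants
  set c₁' : ℝ := max c₁ 0 with hc₁'
  set c₂' : ℝ := max c₂ 0 with hc₂'
  have hc₁'0 : 0 ≤ c₁' := le_max_right _ _
  have hc₂'0 : 0 ≤ c₂' := le_max_right _ _
  -- the rate `a` and the summable majorant `D j = C ρ^j`
  set a : ℝ := σ * Real.log 2 / 2 with ha
  have hlog2 : 0 < Real.log 2 := Real.log_pos one_lt_two
  have ha0 : 0 < a := by positivity
  set b : ℝ := 2 + 4 * c₂' * Real.log 12 with hb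
  set C₀ : ℝ := 2 * c₁' * ((6 + c₂') * (21 + 4 * c₂') * Real.exp (21 * Real.log 12)) with hC₀
  have hC₀0 : 0 ≤ C₀ := by positivity
  set ρ : ℝ := Real.exp (-a) with hρ
  have hρ0 : 0 < ρ := Real.exp_pos _
  have hρ1 : ρ < 1 := Real.exp_lt_one_iff.2 (by linarith)
  set D : ℕ → ℝ := fun j ↦ C₀ * Real.exp (b ^ 2 / (4 * a)) * ρ ^ j with hD
  have hD0 : ∀ j, 0 ≤ D j := fun j ↦ by positivity
  have hDs : Summable D := (summable_geometric_of_lt_one hρ0.le hρ1).mul_left _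
  refine RohdeSchramm.continuousOn_extendFrom_of_modulus (fun p hp ↦ continuousAt_tipApproach hW hp)
    (RohdeSchramm.modulus_of_box (T := 1) hDs hD0 (j₁ := 1) ?_)
  intro j hj k hk y t hy1 hy2 ht1 ht2
  have hk' : k < 4 ^ j := by
    have h : (k : ℝ≥0) < 4 ^ j := by rwa [div_lt_one (by positivity)] at hk
    exact_mod_cast h
  -- `t = t₀ + r`, `t₀ = k 4^{-j}`, `r ≤ 4^{-j}`
  obtain ⟨r, rfl⟩ : ∃ r, t = (k : ℝ≥0) / 4 ^ j + r := ⟨t - _, (add_tsub_cancel_of_le ht1).symm⟩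
  have hr : r ≤ ((4 : ℝ≥0) ^ j)⁻¹ := by
    have e : ((k : ℝ≥0) + 1) / 4 ^ j = (k : ℝ≥0) / 4 ^ j + ((4 : ℝ≥0) ^ j)⁻¹ := by
      rw [add_div, one_div]
    rw [e] at ht2
    exact le_of_add_le_add_left ht2
  have hr1 : r ≤ 1 := hr.trans (inv_le_one_of_one_le₀ (one_le_pow₀ (by norm_num)))
  -- the driver modulus over the box: `m = c₂' √j`
  have hm : |W ((k : ℝ≥0) / 4 ^ j + r) - W ((k : ℝ≥0) / 4 ^ j)| ≤
      c₂' * Real.sqrt j * ((2 : ℝ) ^ j)⁻¹ := by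
    have h2 : (k : ℝ≥0) / 4 ^ j ≤ 2 := hk.le.trans one_le_two
    have h1 : (k : ℝ≥0) / 4 ^ j + r ≤ 2 := by
      calc (k : ℝ≥0) / 4 ^ j + r ≤ 1 + 1 := add_le_add hk.le hr1
        _ = 2 := one_add_one_eq_two
    have h3 : dist ((k : ℝ≥0) / 4 ^ j + r) ((k : ℝ≥0) / 4 ^ j) ≤ ((4 : ℝ) ^ j)⁻¹ := by
      rw [NNReal.dist_eq]
      push_cast
      rw [add_sub_cancel_left, abs_of_nonneg r.coe_nonneg]
      have : (r : ℝ) ≤ ((((4 : ℝ≥0) ^ j)⁻¹ : ℝ≥0) : ℝ) := by exact_mod_cast hr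
      push_cast at this
      exact this
    calc |W ((k : ℝ≥0) / 4 ^ j + r) - W ((k : ℝ≥0) / 4 ^ j)| ≤ c₂ * Real.sqrt j / 2 ^ j :=
          hmodW j hj _ _ h1 h2 h3
      _ ≤ c₂' * Real.sqrt j / 2 ^ j := by gcongr; exact le_max_left _ _
      _ = c₂' * Real.sqrt j * ((2 : ℝ) ^ j)⁻¹ := div_eq_mul_inv _ _
  -- the number of distortion steps `n = ⌈4 (5 + c₂' √j)⌉`
  set n : ℕ := ⌈4 * (5 + c₂' * Real.sqrt j)⌉₊ with hn
  have hn1 : 4 * (5 + c₂' * Real.sqrt j) ≤ n := Nat.le_ceil _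
  have hn2 : (n : ℝ) ≤ 21 + 4 * c₂' * Real.sqrt j := by
    have := Nat.ceil_lt_add_one (show 0 ≤ 4 * (5 + c₂' * Real.sqrt j) by positivity)
    rw [← hn] at this
    linarith
  have core := norm_tipApproach_sub_corner_le hW hy1 hy2 hr hm hn1
  refine core.trans ?_
  -- the derivative at the grid point
  set q : ℝ := ((2 : ℝ) ^ j)⁻¹ with hq
  have hq0 : 0 < q := by positivity
  have hcoe : ((((2 : ℝ≥0) ^ j)⁻¹ : ℝ≥0) : ℝ) = (2 : ℝ) ^ (-(j : ℝ)) := by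
    push_cast
    rw [Real.rpow_neg two_pos.le, Real.rpow_natCast]
  have hder : ‖deriv (fHat W ((k : ℝ≥0) / 4 ^ j)) (I * (((((2 : ℝ≥0) ^ j)⁻¹ : ℝ≥0) : ℝ) : ℂ))‖ ≤
      c₁' * (2 : ℝ) ^ ((1 - σ) * j) := by
    rw [hcoe]
    exact (hgrid j k hk').trans (by gcongr; exact le_max_left _ _)
  -- `2^{-j} · 2^{(1-σ) j} = e^{-2 a j}` and `ρ^j = e^{-a j}`
  have hscale : q * (2 : ℝ) ^ ((1 - σ) * j) = Real.exp (-(2 * a * j)) := by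
    rw [hq, ← Real.rpow_natCast, ← Real.rpow_neg two_pos.le, ← Real.rpow_add two_pos,
      Real.rpow_def_of_pos two_pos, ha]
    congr 1
    ring
  have hρj : ρ ^ j = Real.exp (-(a * j)) := by
    rw [hρ, ← Real.exp_nat_mul]
    congr 1
    ring
  -- the subexponential factors
  set s : ℝ := Real.sqrt j with hs
  have h6m : 6 + c₂' * s ≤ (6 + c₂') * Real.exp s := add_mul_sqrt_le_mul_exp (by norm_num) hc₂'0
  have hn3 : (n : ℝ) ≤ (21 + 4 * c₂') * Real.exp s := by
    refine hn2.trans ?_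
    have := add_mul_sqrt_le_mul_exp (x := (j : ℝ)) (show (0 : ℝ) ≤ 21 by norm_num)
      (show 0 ≤ 4 * c₂' by positivity)
    simpa only [mul_assoc] using this
  have hlog12 : 0 < Real.log 12 := Real.log_pos (by norm_num)
  have h12 : (12 : ℝ) ^ n ≤ Real.exp (21 * Real.log 12) * Real.exp (4 * c₂' * Real.log 12 * s) := by
    rw [← Real.exp_add, ← Real.rpow_natCast, Real.rpow_def_of_pos (by norm_num), Real.exp_le_exp]
    have := mul_le_mul_of_nonneg_left hn2 hlog12.le
    nlinarith
  have hexp : Real.exp s * Real.exp s * Real.exp (4 * c₂' * Real.log 12 * s) = Real.exp (b * s) := by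
    rw [← Real.exp_add, ← Real.exp_add, hb]
    congr 1
    ring
  have hfac : (6 + c₂' * s) * n * 12 ^ n ≤
      (6 + c₂') * (21 + 4 * c₂') * Real.exp (21 * Real.log 12) * Real.exp (b * s) := by
    have hm0 : 0 ≤ 6 + c₂' * s := by positivity
    calc (6 + c₂' * s) * n * 12 ^ n
        ≤ ((6 + c₂') * Real.exp s) * ((21 + 4 * c₂') * Real.exp s) *
            (Real.exp (21 * Real.log 12) * Real.exp (4 * c₂' * Real.log 12 * s)) := by
          gcongr
      _ = (6 + c₂') * (21 + 4 * c₂') * Real.exp (21 * Real.log 12) *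
            (Real.exp s * Real.exp s * Real.exp (4 * c₂' * Real.log 12 * s)) := by ring
      _ = (6 + c₂') * (21 + 4 * c₂') * Real.exp (21 * Real.log 12) * Real.exp (b * s) := by
          rw [hexp]
  have hsub : Real.exp (b * s) ≤ Real.exp (b ^ 2 / (4 * a)) * Real.exp (a * j) :=
    exp_mul_sqrt_le b ha0 (Nat.cast_nonneg j)
  -- conclusion
  have hnn : 0 ≤ 2 * ((6 + c₂' * Real.sqrt j) * ((2 : ℝ) ^ j)⁻¹) * n * 12 ^ n := by positivity
  calc 2 * ((6 + c₂' * Real.sqrt j) * ((2 : ℝ) ^ j)⁻¹) * n * 12 ^ n *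
        ‖deriv (fHat W ((k : ℝ≥0) / 4 ^ j)) (I * (((((2 : ℝ≥0) ^ j)⁻¹ : ℝ≥0) : ℝ) : ℂ))‖
      ≤ 2 * ((6 + c₂' * Real.sqrt j) * ((2 : ℝ) ^ j)⁻¹) * n * 12 ^ n *
          (c₁' * (2 : ℝ) ^ ((1 - σ) * j)) := mul_le_mul_of_nonneg_left hder hnn
    _ = 2 * c₁' * ((6 + c₂' * s) * n * 12 ^ n) * (q * (2 : ℝ) ^ ((1 - σ) * j)) := by
        rw [hs, hq]; ring
    _ ≤ 2 * c₁' * ((6 + c₂') * (21 + 4 * c₂') * Real.exp (21 * Real.log 12) * Real.exp (b * s)) *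
          (q * (2 : ℝ) ^ ((1 - σ) * j)) := by
        gcongr
    _ = C₀ * Real.exp (b * s) * Real.exp (-(2 * a * j)) := by rw [hscale, hC₀]; ring
    _ ≤ C₀ * (Real.exp (b ^ 2 / (4 * a)) * Real.exp (a * j)) * Real.exp (-(2 * a * j)) := by
        gcongr
    _ = D j := by
        have e : Real.exp (a * j) * Real.exp (-(2 * a * j)) = Real.exp (-(a * j)) := by
          rw [← Real.exp_add]
          congr 1
          ring
        rw [hD]
        simp only
        rw [hρj, ← e]
        ring

end Loewner

end Literature.Probability.RandomPlanarGeometry
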